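import Mathlib
import Literature.NumberTheory.LFunctions.FractionalPartAutocorrelation
import HarnessLib

/-!
# RiemannHypothesis / Nyman–Beurling — Vasyunin's formula for the Gram matrix, I: `∫_0^M {px}{qx} x⁻² dx` as finite sums
(layer cake on `(0, M)`; RH-FREE)

Column LI/NB of the RH ladder, rung L-P(P2) «structure of the NB minimiser», PROOF-OF-DATA for cell `pub/rh-li`
[rh-li-eng-3].  The ONE numeric formula behind every certified Nyman–Beurling Gram matrix of the DATA rung (lineages
A / R / C2 of DATA.md §L) is Vasyunin's cotangent formula for the BBLS autocorrelation `A(p/q)`, typed as the NAMED FACT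
`Literature.NumberTheory.LFunctions.BBLS2003_prop89` (arXiv:math/0306251, Prop. 89).  This file and its two sequels
(`NymanBeurlingVasyuninFiniteIdentity.lean`, `NymanBeurlingVasyunin.lean`) DISCHARGE it by an elementary route (no digamma
function, no Gauss multiplication theorem):

1. (this file) on `(0, M)` the fractional part is a layer cake, `{nx} = nx − Σ_{1≤j<nM} 1[j/n ≤ x]`
   (`fract_mul_eq_sub_sum_step`); expanding `{px}{qx}/x²` and integrating the steps gives
   `∫_0^M {px}{qx} x⁻² dx = pqM − Σ_{k<qM} p log(qM/k) − Σ_{j<pM} q log(pM/j) + Σ_{j,k} (1/max(j/p,k/q) − 1/M)`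
   (`integral_fract_mul_fract_eq_sums`), and `Σ_{k<N} log(N/k) = N log N − log N!` (`sum_Ico_mul_log_div`);
2. (part II) the double sum by inclusion–exclusion on the order of `pk` and `qj` — where coprimality and the fractional
   sums `Σ_k {pk/q}/k` enter — giving the FINITE MASTER IDENTITY, then the residue re-indexing and the antisymmetrisation
   `{p(q−r)/q} = 1 − {pr/q}` that produces the cotangent partial fractions;
3. (part III) Stirling, `H_n − log n → γ` and `π cot πx = 1/x + Σ (1/(x−n) + 1/(x+n))` give the limit `M → ∞`, and
   `A(p/q) = q⁻¹ ∫_0^∞ {px}{qx} x⁻² dx` gives Prop. 89, whence `nbGram_eq_vasyunin` (g3's `nbGram_eq_vasyunin_of`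
   made unconditional).

RH-FREE [rh-li-eng-3 g4]: classical real analysis about the fractional part; nothing here bears on `d_N → 0` or on the
truth of RH.  Sources: Báez-Duarte–Balazard–Landreau–Saias, arXiv:math/0306251, Prop. 89; V. I. Vasyunin, St. Petersburg
Math. J. 7 (1996) (statement); the proof route is ours.
-/

noncomputable section

-- D-0017: `Summit.<S>.<S>.…` is the designed namespace of a single-problem summit.
set_option linter.dupNamespace false

open MeasureTheory Set

namespace Summit.RiemannHypothesis.RiemannHypothesis.Theorems.NbTheory

open Literature.NumberTheory.LFunctions

namespace Vasyunin

/-! ## Step 1: the fractional part as a layer cake on `(0, M)` -/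

/-- For `0 < x < M` and `n ≥ 1`: `{nx} = nx − Σ_{1 ≤ j < nM} 1[j/n ≤ x]` (the sum counts `1 ≤ j ≤ ⌊nx⌋`). -/
theorem fract_mul_eq_sub_sum_step {n M : ℕ} (hn : 0 < n) {x : ℝ} (hx0 : 0 < x) (hxM : x < M) :
    Int.fract ((n : ℝ) * x) =
      n * x - ∑ j ∈ Finset.Ico 1 (n * M), (if (j : ℝ) / n ≤ x then (1 : ℝ) else 0) := by
  have hn' : (0 : ℝ) < n := by exact_mod_cast hn
  have hnx : 0 ≤ (n : ℝ) * x := by positivity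
  have hiff : ∀ j : ℕ, ((j : ℝ) / n ≤ x ↔ j ≤ ⌊(n : ℝ) * x⌋₊) := by
    intro j
    rw [div_le_iff₀ hn', Nat.le_floor_iff hnx, mul_comm]
  have hfl : ⌊(n : ℝ) * x⌋₊ < n * M := by
    refine (Nat.floor_lt hnx).mpr ?_
    push_cast
    exact mul_lt_mul_of_pos_left hxM hn'
  have hfilter : (Finset.Ico 1 (n * M)).filter (fun j : ℕ => (j : ℝ) / n ≤ x) =
      Finset.Ico 1 (⌊(n : ℝ) * x⌋₊ + 1) := by
    ext j
    simp only [Finset.mem_filter, Finset.mem_Ico, hiff, Nat.lt_succ_iff]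
    constructor
    · rintro ⟨⟨h1, -⟩, hj⟩
      exact ⟨h1, hj⟩
    · rintro ⟨h1, hj⟩
      exact ⟨⟨h1, lt_of_le_of_lt hj hfl⟩, hj⟩
  rw [Finset.sum_ite, Finset.sum_const_zero, add_zero, Finset.sum_const, nsmul_eq_mul, mul_one, hfilter,
    Nat.card_Ico, Nat.add_sub_cancel, natCast_floor_eq_intCast_floor hnx, ← Int.self_sub_floor]

/-- The pointwise expansion of `{px}{qx}/x²` on `(0,M)` into constant, single steps and double steps. -/
theorem fract_mul_fract_div_sq_eq {p q M : ℕ} (hp : 0 < p) (hq : 0 < q) {x : ℝ} (hx0 : 0 < x) (hxM : x < M) :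
    Int.fract ((p : ℝ) * x) * Int.fract ((q : ℝ) * x) / x ^ 2 =
      (p : ℝ) * q
        - ∑ k ∈ Finset.Ico 1 (q * M), (if (k : ℝ) / q ≤ x then (p : ℝ) / x else 0)
        - ∑ j ∈ Finset.Ico 1 (p * M), (if (j : ℝ) / p ≤ x then (q : ℝ) / x else 0)
        + ∑ j ∈ Finset.Ico 1 (p * M), ∑ k ∈ Finset.Ico 1 (q * M),
            (if max ((j : ℝ) / p) ((k : ℝ) / q) ≤ x then 1 / x ^ 2 else 0) := by
  rw [fract_mul_eq_sub_sum_step hp hx0 hxM, fract_mul_eq_sub_sum_step hq hx0 hxM]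
  set A := ∑ j ∈ Finset.Ico 1 (p * M), (if (j : ℝ) / p ≤ x then (1 : ℝ) else 0) with hA
  set B := ∑ k ∈ Finset.Ico 1 (q * M), (if (k : ℝ) / q ≤ x then (1 : ℝ) else 0) with hB
  have hx' : x ≠ 0 := hx0.ne'
  have h1 : ∑ k ∈ Finset.Ico 1 (q * M), (if (k : ℝ) / q ≤ x then (p : ℝ) / x else 0) = p / x * B := by
    rw [hB, Finset.mul_sum]
    refine Finset.sum_congr rfl fun k _ => ?_
    split_ifs <;> simp
  have h2 : ∑ j ∈ Finset.Ico 1 (p * M), (if (j : ℝ) / p ≤ x then (q : ℝ) / x else 0) = q / x * A := by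
    rw [hA, Finset.mul_sum]
    refine Finset.sum_congr rfl fun j _ => ?_
    split_ifs <;> simp
  have h3 : ∑ j ∈ Finset.Ico 1 (p * M), ∑ k ∈ Finset.Ico 1 (q * M),
      (if max ((j : ℝ) / p) ((k : ℝ) / q) ≤ x then 1 / x ^ 2 else 0) = A * B / x ^ 2 := by
    rw [hA, hB, Finset.sum_mul_sum, Finset.sum_div]
    refine Finset.sum_congr rfl fun j _ => ?_
    rw [Finset.sum_div]
    refine Finset.sum_congr rfl fun k _ => ?_
    by_cases hj : (j : ℝ) / p ≤ x <;> by_cases hk : (k : ℝ) / q ≤ x <;> simp [hj, hk]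
  rw [h1, h2, h3]
  field_simp
  ring

/-! ## Step 2: integrating the steps over `(0, M)` -/

/-- `∫_{(0,M)} 1[a ≤ x] h(x) dx = ∫_a^M h` for `0 < a ≤ M`. -/
theorem setIntegral_Ioo_step {a M : ℝ} (ha : 0 < a) (haM : a ≤ M) (h : ℝ → ℝ) :
    ∫ x in Ioo 0 M, (if a ≤ x then h x else 0) = ∫ x in a..M, h x := by
  have heq : (fun x : ℝ => if a ≤ x then h x else 0) = (Ici a).indicator h := by
    ext x
    simp [Set.indicator_apply, Set.mem_Ici]
  rw [heq, setIntegral_indicator measurableSet_Ici]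
  have hset : Ioo 0 M ∩ Ici a = Ico a M := by
    ext x
    simp only [mem_inter_iff, mem_Ioo, mem_Ici, mem_Ico]
    constructor
    · rintro ⟨⟨-, h2⟩, h3⟩
      exact ⟨h3, h2⟩
    · rintro ⟨h1, h2⟩
      exact ⟨⟨lt_of_lt_of_le ha h1, h2⟩, h1⟩
  rw [hset, integral_Ico_eq_integral_Ioo, ← integral_Ioc_eq_integral_Ioo, intervalIntegral.integral_of_le haM]

/-- Integrability of a step `1[a ≤ x] h(x)` on `(0, M)` for `0 < a` and `h` continuous on `[a, M]`. -/
theorem integrableOn_Ioo_step {a M : ℝ} (ha : 0 < a) {h : ℝ → ℝ} (hh : ContinuousOn h (Icc a M)) :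
    IntegrableOn (fun x : ℝ => if a ≤ x then h x else 0) (Ioo 0 M) := by
  have heq : (fun x : ℝ => if a ≤ x then h x else 0) = (Ici a).indicator h := by
    ext x
    simp [Set.indicator_apply, Set.mem_Ici]
  rw [heq, IntegrableOn, integrable_indicator_iff measurableSet_Ici, IntegrableOn,
    Measure.restrict_restrict measurableSet_Ici]
  have hset : Ici a ∩ Ioo 0 M = Ico a M := by
    ext x
    simp only [mem_inter_iff, mem_Ioo, mem_Ici, mem_Ico]
    constructor
    · rintro ⟨h3, -, h2⟩
      exact ⟨h3, h2⟩
    · rintro ⟨h1, h2⟩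
      exact ⟨h1, lt_of_lt_of_le ha h1, h2⟩
  rw [hset]
  exact (hh.integrableOn_compact isCompact_Icc).mono_set Ico_subset_Icc_self

/-- `∫_a^M c/x dx = c log(M/a)` for `0 < a ≤ M`. -/
theorem integral_const_div {a M : ℝ} (ha : 0 < a) (haM : a ≤ M) (c : ℝ) :
    ∫ x in a..M, c / x = c * Real.log (M / a) := by
  have h0 : (0 : ℝ) ∉ uIcc a M := by
    rw [uIcc_of_le haM]
    intro h
    exact absurd h.1 (not_le.mpr ha)
  calc ∫ x in a..M, c / x = ∫ x in a..M, c * x⁻¹ := by simp_rw [div_eq_mul_inv]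
    _ = c * Real.log (M / a) := by rw [intervalIntegral.integral_const_mul, integral_inv h0]

/-- `∫_a^M dx/x² = 1/a − 1/M` for `0 < a ≤ M`. -/
theorem integral_one_div_sq {a M : ℝ} (ha : 0 < a) (haM : a ≤ M) :
    ∫ x in a..M, 1 / x ^ 2 = 1 / a - 1 / M := by
  have hderiv : ∀ x ∈ uIcc a M, HasDerivAt (fun y : ℝ => -y⁻¹) (1 / x ^ 2) x := by
    intro x hx
    rw [uIcc_of_le haM] at hx
    have hx0 : x ≠ 0 := (lt_of_lt_of_le ha hx.1).ne'
    have h := (hasDerivAt_inv hx0).neg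
    refine h.congr_deriv ?_
    field_simp
  have hint : IntervalIntegrable (fun x : ℝ => 1 / x ^ 2) volume a M := by
    refine (continuousOn_of_forall_continuousAt fun x hx => ?_).intervalIntegrable
    rw [uIcc_of_le haM] at hx
    have hx0 : x ≠ 0 := (lt_of_lt_of_le ha hx.1).ne'
    have hx2 : x ^ 2 ≠ 0 := pow_ne_zero 2 hx0
    fun_prop (disch := assumption)
  rw [intervalIntegral.integral_eq_sub_of_hasDerivAt hderiv hint]
  have hM0 : M ≠ 0 := (lt_of_lt_of_le ha haM).ne'
  have ha0 : a ≠ 0 := ha.ne'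
  field_simp
  ring

/-- The integral of `{px}{qx}/x²` over `(0, M)` in terms of finite sums (before any simplification). -/
theorem integral_fract_mul_fract_eq_sums {p q M : ℕ} (hp : 0 < p) (hq : 0 < q) (hM : 0 < M) :
    ∫ x in (0 : ℝ)..M, Int.fract ((p : ℝ) * x) * Int.fract ((q : ℝ) * x) / x ^ 2 =
      (p : ℝ) * q * M
        - ∑ k ∈ Finset.Ico 1 (q * M), (p : ℝ) * Real.log (M / ((k : ℝ) / q))
        - ∑ j ∈ Finset.Ico 1 (p * M), (q : ℝ) * Real.log (M / ((j : ℝ) / p))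
        + ∑ j ∈ Finset.Ico 1 (p * M), ∑ k ∈ Finset.Ico 1 (q * M),
            (1 / max ((j : ℝ) / p) ((k : ℝ) / q) - 1 / M) := by
  have hM' : (0 : ℝ) < M := by exact_mod_cast hM
  have hp' : (0 : ℝ) < p := by exact_mod_cast hp
  have hq' : (0 : ℝ) < q := by exact_mod_cast hq
  -- thresholds lie in (0, M]
  have hk_pos : ∀ k ∈ Finset.Ico 1 (q * M), (0 : ℝ) < (k : ℝ) / q := by
    intro k hk
    rw [Finset.mem_Ico] at hk
    have : (1 : ℝ) ≤ k := by exact_mod_cast hk.1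
    positivity
  have hk_le : ∀ k ∈ Finset.Ico 1 (q * M), (k : ℝ) / q ≤ M := by
    intro k hk
    rw [Finset.mem_Ico] at hk
    rw [div_le_iff₀ hq']
    have : (k : ℝ) < (q * M : ℕ) := by exact_mod_cast hk.2
    push_cast at this
    linarith
  have hj_pos : ∀ j ∈ Finset.Ico 1 (p * M), (0 : ℝ) < (j : ℝ) / p := by
    intro j hj
    rw [Finset.mem_Ico] at hj
    have : (1 : ℝ) ≤ j := by exact_mod_cast hj.1
    positivity
  have hj_le : ∀ j ∈ Finset.Ico 1 (p * M), (j : ℝ) / p ≤ M := by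
    intro j hj
    rw [Finset.mem_Ico] at hj
    rw [div_le_iff₀ hp']
    have : (j : ℝ) < (p * M : ℕ) := by exact_mod_cast hj.2
    push_cast at this
    linarith
  have hcont1 : ∀ (a c : ℝ), 0 < a → ContinuousOn (fun x : ℝ => c / x) (Icc a M) := by
    intro a c ha
    refine continuousOn_of_forall_continuousAt fun x hx => ?_
    have hx0 : x ≠ 0 := (lt_of_lt_of_le ha hx.1).ne'
    fun_prop (disch := assumption)
  have hcont2 : ∀ a : ℝ, 0 < a → ContinuousOn (fun x : ℝ => 1 / x ^ 2) (Icc a M) := by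
    intro a ha
    refine continuousOn_of_forall_continuousAt fun x hx => ?_
    have hx0 : x ≠ 0 := (lt_of_lt_of_le ha hx.1).ne'
    have hx2 : x ^ 2 ≠ 0 := pow_ne_zero 2 hx0
    fun_prop (disch := assumption)
  -- pass to the set integral over Ioo 0 M and expand pointwise
  rw [intervalIntegral.integral_of_le hM'.le, integral_Ioc_eq_integral_Ioo,
    setIntegral_congr_fun measurableSet_Ioo (fun x hx => fract_mul_fract_div_sq_eq (M := M) hp hq hx.1 hx.2)]
  -- integrability of the pieces
  have iK : ∀ k ∈ Finset.Ico 1 (q * M),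
      IntegrableOn (fun x : ℝ => if (k : ℝ) / q ≤ x then (p : ℝ) / x else 0) (Ioo 0 M) :=
    fun k hk => integrableOn_Ioo_step (hk_pos k hk) (hcont1 _ _ (hk_pos k hk))
  have iJ : ∀ j ∈ Finset.Ico 1 (p * M),
      IntegrableOn (fun x : ℝ => if (j : ℝ) / p ≤ x then (q : ℝ) / x else 0) (Ioo 0 M) :=
    fun j hj => integrableOn_Ioo_step (hj_pos j hj) (hcont1 _ _ (hj_pos j hj))
  have iJK : ∀ j ∈ Finset.Ico 1 (p * M), ∀ k ∈ Finset.Ico 1 (q * M),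
      IntegrableOn (fun x : ℝ => if max ((j : ℝ) / p) ((k : ℝ) / q) ≤ x then 1 / x ^ 2 else 0) (Ioo 0 M) :=
    fun j hj k hk => integrableOn_Ioo_step (lt_max_of_lt_left (hj_pos j hj)) (hcont2 _ (lt_max_of_lt_left (hj_pos j hj)))
  have iC : IntegrableOn (fun _ : ℝ => (p : ℝ) * q) (Ioo 0 M) := integrableOn_const (by simp)
  have iSK : IntegrableOn (fun x : ℝ => ∑ k ∈ Finset.Ico 1 (q * M),
      (if (k : ℝ) / q ≤ x then (p : ℝ) / x else 0)) (Ioo 0 M) :=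
    integrable_finsetSum _ iK
  have iSJ : IntegrableOn (fun x : ℝ => ∑ j ∈ Finset.Ico 1 (p * M),
      (if (j : ℝ) / p ≤ x then (q : ℝ) / x else 0)) (Ioo 0 M) :=
    integrable_finsetSum _ iJ
  have iSJK : IntegrableOn (fun x : ℝ => ∑ j ∈ Finset.Ico 1 (p * M), ∑ k ∈ Finset.Ico 1 (q * M),
      (if max ((j : ℝ) / p) ((k : ℝ) / q) ≤ x then 1 / x ^ 2 else 0)) (Ioo 0 M) :=
    integrable_finsetSum _ fun j hj => integrable_finsetSum _ fun k hk => iJK j hj k hk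
  have i1 : IntegrableOn (fun x : ℝ => (p : ℝ) * q
      - ∑ k ∈ Finset.Ico 1 (q * M), (if (k : ℝ) / q ≤ x then (p : ℝ) / x else 0)) (Ioo 0 M) :=
    iC.sub' iSK
  have i2 : IntegrableOn (fun x : ℝ => (p : ℝ) * q
      - ∑ k ∈ Finset.Ico 1 (q * M), (if (k : ℝ) / q ≤ x then (p : ℝ) / x else 0)
      - ∑ j ∈ Finset.Ico 1 (p * M), (if (j : ℝ) / p ≤ x then (q : ℝ) / x else 0)) (Ioo 0 M) :=
    i1.sub' iSJ
  rw [integral_add i2 iSJK, integral_sub i1 iSJ, integral_sub iC iSK,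
    integral_finsetSum _ iK, integral_finsetSum _ iJ,
    integral_finsetSum _ (fun j hj => integrable_finsetSum _ fun k hk => iJK j hj k hk)]
  -- evaluate each piece
  have eC : ∫ _ in Ioo (0 : ℝ) M, (p : ℝ) * q = (p : ℝ) * q * M := by
    rw [setIntegral_const, Real.volume_real_Ioo_of_le hM'.le, sub_zero, smul_eq_mul]
    ring
  have eK : ∀ k ∈ Finset.Ico 1 (q * M),
      ∫ x in Ioo (0 : ℝ) M, (if (k : ℝ) / q ≤ x then (p : ℝ) / x else 0) = p * Real.log (M / ((k : ℝ) / q)) := by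
    intro k hk
    rw [setIntegral_Ioo_step (hk_pos k hk) (hk_le k hk), integral_const_div (hk_pos k hk) (hk_le k hk)]
  have eJ : ∀ j ∈ Finset.Ico 1 (p * M),
      ∫ x in Ioo (0 : ℝ) M, (if (j : ℝ) / p ≤ x then (q : ℝ) / x else 0) = q * Real.log (M / ((j : ℝ) / p)) := by
    intro j hj
    rw [setIntegral_Ioo_step (hj_pos j hj) (hj_le j hj), integral_const_div (hj_pos j hj) (hj_le j hj)]
  have eJK : ∀ j ∈ Finset.Ico 1 (p * M), ∀ k ∈ Finset.Ico 1 (q * M),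
      ∫ x in Ioo (0 : ℝ) M, (if max ((j : ℝ) / p) ((k : ℝ) / q) ≤ x then 1 / x ^ 2 else 0) =
        1 / max ((j : ℝ) / p) ((k : ℝ) / q) - 1 / M := by
    intro j hj k hk
    have hpos : 0 < max ((j : ℝ) / p) ((k : ℝ) / q) := lt_max_of_lt_left (hj_pos j hj)
    have hle : max ((j : ℝ) / p) ((k : ℝ) / q) ≤ M := max_le (hj_le j hj) (hk_le k hk)
    rw [setIntegral_Ioo_step hpos hle (fun x : ℝ => 1 / x ^ 2), integral_one_div_sq hpos hle]
  rw [eC, Finset.sum_congr rfl eK, Finset.sum_congr rfl eJ,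
    Finset.sum_congr rfl fun j hj => (integral_finsetSum _ fun k hk => iJK j hj k hk).trans
      (Finset.sum_congr rfl fun k hk => eJK j hj k hk)]

/-! ## Step 3: the logarithmic sums -/

/-- `Σ_{1 ≤ k ≤ N} log k = log N!`. -/
theorem sum_Ico_log_eq_log_factorial (N : ℕ) :
    ∑ k ∈ Finset.Ico 1 (N + 1), Real.log k = Real.log (N.factorial) := by
  induction N with
  | zero => simp
  | succ N ih =>
    rw [Finset.sum_Ico_succ_top (by omega), ih, Nat.factorial_succ, Nat.cast_mul,
      Real.log_mul (by positivity) (by positivity)]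
    push_cast
    ring

/-- `Σ_{1 ≤ k < N} c·log(M/(k/n)) = c·(N log N − log N!)` when `n M = N ≥ 1` (the single-step integrals summed). -/
theorem sum_Ico_mul_log_div {n M : ℕ} (hn : 0 < n) (hM : 0 < M) (c : ℝ) :
    ∑ k ∈ Finset.Ico 1 (n * M), c * Real.log (M / ((k : ℝ) / n)) =
      c * ((n : ℝ) * M * Real.log ((n : ℝ) * M) - Real.log ((n * M).factorial)) := by
  have hn' : (0 : ℝ) < n := by exact_mod_cast hn
  have hM' : (0 : ℝ) < M := by exact_mod_cast hM
  obtain ⟨N, hN⟩ : ∃ N : ℕ, n * M = N + 1 := ⟨n * M - 1, by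
    have : 1 ≤ n * M := Nat.one_le_iff_ne_zero.mpr (Nat.mul_ne_zero hn.ne' hM.ne'); omega⟩
  have hcast : (n : ℝ) * M = (N : ℝ) + 1 := by exact_mod_cast hN
  rw [hN, ← Finset.mul_sum]
  congr 1
  have hterm : ∀ k ∈ Finset.Ico 1 (N + 1), Real.log (M / ((k : ℝ) / n)) = Real.log ((N : ℝ) + 1) - Real.log k := by
    intro k hk
    rw [Finset.mem_Ico] at hk
    have hk0 : (0 : ℝ) < k := by exact_mod_cast hk.1
    rw [← hcast, ← Real.log_div (by positivity) hk0.ne']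
    congr 1
    field_simp
  rw [Finset.sum_congr rfl hterm, Finset.sum_sub_distrib, Finset.sum_const, Nat.card_Ico, nsmul_eq_mul,
    sum_Ico_log_eq_log_factorial, hcast, Nat.factorial_succ, Nat.cast_mul,
    Real.log_mul (by positivity) (by positivity)]
  push_cast
  ring

end Vasyunin

end Summit.RiemannHypothesis.RiemannHypothesis.Theorems.NbTheory

end
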